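import Summits.QuantumFields.GaugeBoot.PlanarClassIdentificationsZd
import Summits.QuantumFields.GaugeBoot.PlanarBootstrapLargeNRate
import Literature.MathematicalPhysics.QuantumFieldTheory.Balaban1983to89.InfiniteVolumeSufficientIV
import HarnessLib

/-!
# The class-indexed relaxation variables of Kazakov–Zheng cost `O(1/N)` at strong 't Hooft coupling — modulo Shen–Zhu–Zhu (gauge-boot, large-`N` supplement 12)

HONEST FRAMING (cell `pub-gaugeboot`, page 1 of every file): the venture produces certified bounds
on lattice expectations at stated coupling, gauge group, dimension and torus size; NOT a mass gap,
NOT a continuum limit, NOT a string tension; NOT large `N` unless marked CONDITIONAL; NOT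
Yang–Mills-summit-bearing (barriers `FixedCouplingUltralocality`, `PerturbativeInvisibility`).
CONDITIONAL on the tree's named fact `shenZhuZhu_largeN_variance` (SZZ CMP 400 (2023) Cor. 1.5
(1.12)); this file certifies no number.

## Content

Supplement 7 (`PlanarClassIdentificationsZd`) showed that identifying the relaxation variables of
SEPARATELY moved pairs — `Q(A', B)` with `Q(A, B)` for a translated copy `A' = p·A·p⁻¹` of `A`, as a
class-indexed `Q_{ij}` does — costs `E‖t_{A'} − E t_{A'}‖ + E‖t_A − E t_A‖` at finite `N`.  With SZZ's
variance bound this is quantitative: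

* `variance_loopTrZd_le_of_szz` — GIVEN SZZ (1.12), `d ≥ 2`, `|βt| < 1/(16(d−1))`, a limit point `μ`
  at tree coupling `N·βt`, `N ≥ 1`, and a word `A` based at `y` realised by a non-backtracking closed
  walk `γ`: `Var(Re t_y(A)) + Var(Im t_y(A)) ≤ 4 n_γ(n_γ−3)/(c₀ N²)`;
* ★★ `abs_loopQ_conjPath_sub_loopQ_le_of_szz` — hence, for `A` closed at `x`, a path `p` from `x` to
  `y`, and realising walks for `A` at `x` AND at `y`:
  `|Q_x(p·A·p⁻¹, B) − Q_x(A, B)| ≤ (√(4 n_{γ'}(n_{γ'}−3)/c₀) + √(4 n_γ(n_γ−3)/c₀)) / N` —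
  **the class-indexed relaxation variables are consistent at finite `N` up to `O(1/N)`** (translation
  invariance of limit points: `isZdTranslationInvariant_of_mem_infiniteVolumeLimitPoints`, tree).

So a certificate of KZ's SDP as printed (class-indexed `Q`) replays on `SU(N)` at strong coupling
with total defect `O(1/N)` (its identification rows, via `PlanarCertificate.obj_loopW_le'`), against
`O(1/N²)` for the position-indexed format of this lane (`PlanarBootstrapLargeNRate`).  Whether the
`O(1/N)` is sharp is not claimed.  [folklore] on top of SZZ.
-/

noncomputable section

open MeasureTheory ProbabilityTheory
open scoped BigOperators
open Literature.Probability.LatticeModels (Site zdGraph)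
open Literature.MathematicalPhysics.QuantumLattice
open Literature.MathematicalPhysics.QuantumFieldTheory (szzThresholdSU shenZhuZhu_largeN_variance IsNonBacktrackingLoop
  wilsonLoopTrace wilsonLoopTrace_apply)

namespace Summit.QuantumFields.GaugeBoot

variable {d N : ℕ}

/-- **SZZ's variance bound in the lane's variables**: GIVEN (1.12), for `d ≥ 2`, `|βt| < 1/(16(d−1))`,
`N ≥ 1`, a thermodynamic limit point `μ` at tree coupling `N·βt` and a word `A` based at `y` realised by
a non-backtracking closed walk `γ`: `Var(Re t_y(A)) + Var(Im t_y(A)) ≤ 4 n_γ(n_γ−3)/(c₀ N²)`.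
[cite: ShenZhuZhuCMP2023, Corollary 1.5] -/
theorem variance_loopTrZd_le_of_szz (hfact : ∀ N, shenZhuZhu_largeN_variance d N) (hd : 2 ≤ d) {βt : ℝ}
    (hβ : |βt| < szzThresholdSU d) (hN : 1 ≤ N) {μ : Measure (LGConfig d (Matrix.specialUnitaryGroup (Fin N) ℂ))}
    (hμ : μ ∈ infiniteVolumeLimitPoints (d := d) (fundamentalRep (Fin N)) ((N : ℝ) * βt))
    (y : Site d) (A : Word d) (γ : (zdGraph d).Walk y y) (hγ : IsNonBacktrackingLoop γ)
    (hhol : ∀ U : LGConfig d (Matrix.specialUnitaryGroup (Fin N) ℂ), walkHolonomy U γ = wordHolonomyZd U y A) :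
    Var[fun U => (loopTrZd (fundamentalRep (Fin N)) y A U).re; μ] + Var[fun U => (loopTrZd (fundamentalRep (Fin N)) y A U).im; μ] ≤
      4 * ((γ.length : ℝ) * ((γ.length : ℝ) - 3)) / szzPlanarSlope d βt / (N : ℝ) ^ 2 := by
  have hvar := (hfact N).1 hd hN βt hβ μ hμ y γ hγ
  have hre : (fun U : LGConfig d (Matrix.specialUnitaryGroup (Fin N) ℂ) => (loopTrZd (fundamentalRep (Fin N)) y A U).re) =
      fun U => (wilsonLoopTrace (fundamentalRep (Fin N)) γ U).re / N := by
    funext U; rw [loopTrZd_apply, Complex.div_natCast_re, wilsonLoopTrace_apply, hhol U]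
  have him : (fun U : LGConfig d (Matrix.specialUnitaryGroup (Fin N) ℂ) => (loopTrZd (fundamentalRep (Fin N)) y A U).im) =
      fun U => (wilsonLoopTrace (fundamentalRep (Fin N)) γ U).im / N := by
    funext U; rw [loopTrZd_apply, Complex.div_natCast_im, wilsonLoopTrace_apply, hhol U]
  rw [hre, him]
  refine hvar.trans (le_of_eq ?_)
  have hc : 0 < szzPlanarSlope d βt := szzPlanarSlope_pos hd hβ
  have hN' : (0 : ℝ) < N := by exact_mod_cast hN
  rw [szzBakryEmeryConstSU_eq_mul_slope]
  field_simp

/-- `√(a / N²) = √a / N` for `N ≥ 1`, and monotonicity: a variance bound `≤ a/N²` gives `√Var ≤ √a / N`. [folklore] -/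
theorem sqrt_le_sqrt_div_of_le {v a : ℝ} {N : ℕ} (hN : 1 ≤ N) (h : v ≤ a / (N : ℝ) ^ 2) :
    Real.sqrt v ≤ Real.sqrt a / N := by
  have hN' : (0 : ℝ) < N := by exact_mod_cast hN
  calc Real.sqrt v ≤ Real.sqrt (a / (N : ℝ) ^ 2) := Real.sqrt_le_sqrt h
    _ = Real.sqrt a / N := by rw [Real.sqrt_div' _ (by positivity), Real.sqrt_sq hN'.le]

/-- ★★ **KZ's class-indexed relaxation variables are consistent at finite `N` up to `O(1/N)`** (given
SZZ (1.12)): `d ≥ 2`, `|βt| < 1/(16(d−1))`, `N ≥ 1`, `μ` a thermodynamic limit point of the `SU(N)`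
torus Wilson states at tree coupling `N·βt`; `A` closed at `x`, `p` a path from `x` to `y`,
`A' = p·A·p⁻¹` its copy at `y` read from `x`; `γ` (at `x`) and `γ'` (at `y`) non-backtracking closed
walks realising `A`.  Then
`|Q_x(A', B) − Q_x(A, B)| ≤ (√(4 n_{γ'}(n_{γ'}−3)/c₀) + √(4 n_γ(n_γ−3)/c₀)) / N`.
[cite: ShenZhuZhuCMP2023, Corollary 1.5] -/
theorem abs_loopQ_conjPath_sub_loopQ_le_of_szz (hfact : ∀ N, shenZhuZhu_largeN_variance d N) (hd : 2 ≤ d) {βt : ℝ}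
    (hβ : |βt| < szzThresholdSU d) (hN : 1 ≤ N) {μ : Measure (LGConfig d (Matrix.specialUnitaryGroup (Fin N) ℂ))}
    (hμ : μ ∈ infiniteVolumeLimitPoints (d := d) (fundamentalRep (Fin N)) ((N : ℝ) * βt))
    (x : Site d) (p A B : Word d) (hA : Word.endpointZd x A = x)
    (γ : (zdGraph d).Walk x x) (hγ : IsNonBacktrackingLoop γ)
    (hhol : ∀ U : LGConfig d (Matrix.specialUnitaryGroup (Fin N) ℂ), walkHolonomy U γ = wordHolonomyZd U x A)
    (γ' : (zdGraph d).Walk (Word.endpointZd x p) (Word.endpointZd x p)) (hγ' : IsNonBacktrackingLoop γ')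
    (hhol' : ∀ U : LGConfig d (Matrix.specialUnitaryGroup (Fin N) ℂ), walkHolonomy U γ' = wordHolonomyZd U (Word.endpointZd x p) A) :
    |loopQ (fundamentalRep (Fin N)) μ x (p ++ A ++ p.reverse) B - loopQ (fundamentalRep (Fin N)) μ x A B| ≤
      (Real.sqrt (4 * ((γ'.length : ℝ) * ((γ'.length : ℝ) - 3)) / szzPlanarSlope d βt) +
        Real.sqrt (4 * ((γ.length : ℝ) * ((γ.length : ℝ) - 3)) / szzPlanarSlope d βt)) / N := by
  haveI : SecondCountableTopology (Matrix (Fin N) (Fin N) ℂ) :=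
    inferInstanceAs (SecondCountableTopology (Fin N → Fin N → ℂ))
  haveI : SecondCountableTopology (Matrix.specialUnitaryGroup (Fin N) ℂ) :=
    Topology.IsEmbedding.subtypeVal.secondCountableTopology
  haveI : IsProbabilityMeasure μ := by obtain ⟨L, -, hL⟩ := hμ; exact hL.1
  have hT : IsZdTranslationInvariant μ := isZdTranslationInvariant_of_mem_infiniteVolumeLimitPoints (fundamentalRep (Fin N)) hμ
  have hρ := continuous_fundamentalRep (Fin N)
  have hA' : Word.endpointZd (Word.endpointZd x p) A = Word.endpointZd x p := Word.endpointZd_eq_self_of_closed hA _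
  -- means agree: conjugation + translation invariance
  have hmean : ∫ U, loopTrZd (fundamentalRep (Fin N)) x (p ++ A ++ p.reverse) U ∂μ = ∫ U, loopTrZd (fundamentalRep (Fin N)) x A U ∂μ := by
    simp only [loopTrZd_conjPath _ x p A hA', loopTrZd_apply, integral_div]
    rw [show Word.endpointZd x p = x + (Word.endpointZd x p - x) by abel, integral_trace_wordHolonomyZd_add _ hT]
  refine (abs_loopQ_sub_loopQ_le_sqrt _ hρ μ x A _ B hmean).trans ?_
  rw [add_div]
  refine add_le_add ?_ ?_
  · -- the translated copy: its variances are those of `t_y(A)`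
    have hv := variance_loopTrZd_le_of_szz hfact hd hβ hN hμ (Word.endpointZd x p) A γ' hγ' hhol'
    refine sqrt_le_sqrt_div_of_le hN ?_
    have e1 : (fun U => (loopTrZd (fundamentalRep (Fin N)) x (p ++ A ++ p.reverse) U).re) =
        fun U => (loopTrZd (fundamentalRep (Fin N)) (Word.endpointZd x p) A U).re :=
      funext fun U => by rw [loopTrZd_conjPath _ x p A hA' U]
    have e2 : (fun U => (loopTrZd (fundamentalRep (Fin N)) x (p ++ A ++ p.reverse) U).im) =
        fun U => (loopTrZd (fundamentalRep (Fin N)) (Word.endpointZd x p) A U).im :=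
      funext fun U => by rw [loopTrZd_conjPath _ x p A hA' U]
    rw [e1, e2]
    exact hv
  · exact sqrt_le_sqrt_div_of_le hN (variance_loopTrZd_le_of_szz hfact hd hβ hN hμ x A γ hγ hhol)

end Summit.QuantumFields.GaugeBoot

end
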